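import Literature.MathematicalPhysics.QuantumFieldTheory.Balaban1983to89.Node00.MultiScaleFibreChartLocalityComponent
import Literature.MathematicalPhysics.QuantumFieldTheory.Balaban1983to89.Node00.MultiScaleFibreChartB

/-!
# NODE 00 — COMPONENT-WISE LOCALITY OF THE BOND-DATUM CHART `msChartB` AND THE EXACT Γ₀ LAYER — the print-datum ([Balaban1984PropagatorsII] (2.3)) edition of
# `Node00/MultiScaleFibreChartLocalityComponent` (all seven theorems), keyed on the lane's `Node00/MultiScaleFibreChartB`

statement-level skeleton of published theorems with citation tags; proofs where landed; nothing here is a claim about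
the Yang–Mills mass gap

Cell `pub-ymgap` (HUMAN RULINGS D-0062 ∕ D-0149), lane `pub-ymgap-dag-n12-c` g35 (R134 seat (a), N12 = [B15], s1, lane owner); `--kind proof --supports` K1⁹ `stmt-QuantumFields-27364`;
count-neutral.  THEOREMS ONLY (0 `def`, 0 `instance`, 0 `sorry`).  (E1) variant (iii-b), class (γ) of the lane's census-by-declaration (bus [DAGN12C-G35], 2026-08-30): three declarations of the parent
with datum-bearing statements are used by N12's junction of record v14ᴸ (`fderiv_fderiv_msChart_apply_levelZero`, `fderiv_msChart_apply_levelZero`, `msChart_apply_levelZero_eventuallyEq` — the Γ₀ layer,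
where under print's datum the level-`0` constrained bonds are `lamBondsSeq Ω k 0` = the bonds with both end-points off `Ω₁`).  GENERATOR twin (HOME `lean/g35/gen/gen_LocCompB.py`, substitutions asserted:
`DetSet ↦ BDetSet`, `AgreeOn ↦ AgreeOnB`, `bondsOf (𝐁 0) ↦ 𝔅 0`, `msChart ∕ constrCard ∕ constrEnum ↦ …B`); the datum-free locality of `M^j` (`iter_local`, `feeds`), dag-n10-w1's
`fderiv_fderiv_apply_pi ∕ fderiv_fderiv_congr_of_eventuallyEq` and `B7BlockAvgLog.mlog_exp` REUSED by name.

HONESTY GUARD (director-ym №338 (5)).  PURELY ADDITIVE: the parent stays landed and true on its own text; nothing in it is edited; no displayed premise of any consumer is deleted or weakened.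
Nothing of [15] asserted; K0⁷ ∕ K1⁹ NOT closed; N07 ∕ N12 NOT discharged; one finite 𝕋⁴ programme at fixed ε — NOT continuum ∕ ℝ⁴ ∕ OS ∕ mass gap ∕ Clay.

WHAT IS HERE.  §1 ★★ `msChartB_apply_congr_of_eqOn_feeds` (+ `_left ∕ _right`) · ★ `fderiv_msChartB_apply_congr_of_eqOn_feeds`; §2 ★★ `msChartB_apply_levelZero_eventuallyEq` · ★★ `fderiv_msChartB_apply_levelZero` ·
★★ `fderiv_fderiv_msChartB_apply_levelZero`.

References: [III] = [Balaban1988Convergent] (2.2) p.255, (2.10)–(2.12) p.256; [I] = [Balaban1987RG1] (0.4) p.253; [15] = [Balaban1985Variational] Sect. C (47)–(48) p.285, (81)–(83) p.290;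
[Balaban1985Averaging] (21)–(26) pp.21–22; [II] = [Balaban1984PropagatorsII] (2.3) p.224.
-/

noncomputable section

namespace Literature.MathematicalPhysics.QuantumFieldTheory.Balaban1983to89.Node00

open Filter Topology
open T4Continuum (T4Family)
open B15DeterminingSets B15DeterminingSetsB
open B14.Eq216Concrete (feeds inputs mem_inputs iter_local)
open T4AdjointCovarianceUnitary (lieSU expSU)
open MatrixLog (mlog)
open scoped Matrix.Norms.L2Operator

variable {F : T4Family} {N : ℕ} [NeZero N]
variable {K k : ℕ} {𝔅 : BDetSet (F.P K)} {W : MSField (F.P K) (SU N)} {U U' : GaugeField (F.P K) 0 (SU N)}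

/-! ## §1  The `(j, c)`-component reads `U` and `X` only on `feeds j c` -/

/-- ★★ **COMPONENT-WISE LOCALITY OF THE CHART OF RECORD** (standing range `k ≤ m + K`): if the charted configurations `U·e^X` and `U′·e^{X′}` agree on the tower `feeds j_i c_i` of
the `i`-th constrained bond, then the `i`-th components of `Ψ_{𝐁,W,U}(X)` and `Ψ_{𝐁,W,U′}(X′)` agree — [III] (2.11)'s locality of `M^j` (`iter_local`) read through n07-w2's definition.
[cite: Balaban1988Convergent, (2.11) p.256; Balaban1987RG1, (0.4) p.253; Balaban1985Variational, (82)–(83) p.290] -/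
theorem msChartB_apply_congr_of_eqOn_feeds (hk : k ≤ (F.P K).m + (F.P K).K) (i : Fin (constrCardB 𝔅 k))
    {X X' : PBond (F.P K) 0 → lieSU (Fin N)}
    (h : ∀ b ∈ feeds (((constrEnumB 𝔅 k).symm i).1 : ℕ) ((constrEnumB 𝔅 k).symm i).2.1, expChart U X b = expChart U' X' b) :
    msChartB F N K k 𝔅 W U X i = msChartB F N K k 𝔅 W U' X' i := by
  have hj : (((constrEnumB 𝔅 k).symm i).1 : ℕ) ≤ (F.P K).m + (F.P K).K := (Nat.le_of_lt_succ ((constrEnumB 𝔅 k).symm i).1.2).trans hk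
  have hav : avgFamily (avOfRecord F N K) (expChart U X) (((constrEnumB 𝔅 k).symm i).1 : ℕ) ((constrEnumB 𝔅 k).symm i).2.1
      = avgFamily (avOfRecord F N K) (expChart U' X') (((constrEnumB 𝔅 k).symm i).1 : ℕ) ((constrEnumB 𝔅 k).symm i).2.1 :=
    iter_local (avOfRecord F N K) _ hj _ _ _ h
  rw [msChartB_apply, msChartB_apply, relAvg, relAvg, hav]

/-- Same chart variable: `U = U′` on `feeds j_i c_i` ⇒ the `i`-th components of `Ψ_{𝐁,W,U}(X)` and `Ψ_{𝐁,W,U′}(X)` agree. [cite: Balaban1988Convergent, (2.11) p.256] -/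
theorem msChartB_apply_congr_of_eqOn_feeds_left (hk : k ≤ (F.P K).m + (F.P K).K) (i : Fin (constrCardB 𝔅 k))
    (h : ∀ b ∈ feeds (((constrEnumB 𝔅 k).symm i).1 : ℕ) ((constrEnumB 𝔅 k).symm i).2.1, U b = U' b) (X : PBond (F.P K) 0 → lieSU (Fin N)) :
    msChartB F N K k 𝔅 W U X i = msChartB F N K k 𝔅 W U' X i :=
  msChartB_apply_congr_of_eqOn_feeds hk i fun b hb => by unfold expChart; rw [h b hb]

/-- Same configuration: `X = X′` on `feeds j_i c_i` ⇒ the `i`-th components of `Ψ_{𝐁,W,U}(X)` and `Ψ_{𝐁,W,U}(X′)` agree. [cite: Balaban1988Convergent, (2.11) p.256] -/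
theorem msChartB_apply_congr_of_eqOn_feeds_right (hk : k ≤ (F.P K).m + (F.P K).K) (i : Fin (constrCardB 𝔅 k))
    {X X' : PBond (F.P K) 0 → lieSU (Fin N)} (h : ∀ b ∈ feeds (((constrEnumB 𝔅 k).symm i).1 : ℕ) ((constrEnumB 𝔅 k).symm i).2.1, X b = X' b) :
    msChartB F N K k 𝔅 W U X i = msChartB F N K k 𝔅 W U X' i :=
  msChartB_apply_congr_of_eqOn_feeds hk i fun b hb => by unfold expChart; rw [h b hb]

/-- ★ **THE DERIVATIVE OF THE `i`-TH COMPONENT READS THE DIRECTION ONLY ON `feeds j_i c_i`**: for `Ψ` differentiable at `0` (e.g. on the guard, `differentiableAt_msChartB`), `w = w′` on the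
tower ⇒ `(DΨ(0) w) i = (DΨ(0) w′) i`.  Proof: the `i`-th component factors through the (linear) restriction to the tower, `Ψ_i = Ψ_i ∘ P`, so `DΨ_i(0) = DΨ_i(0) ∘ P`.
[cite: Balaban1988Convergent, (2.11) p.256; Balaban1985Variational, (82)–(83) p.290] -/
theorem fderiv_msChartB_apply_congr_of_eqOn_feeds (hk : k ≤ (F.P K).m + (F.P K).K) (hΨ : DifferentiableAt ℝ (msChartB F N K k 𝔅 W U) 0)
    (i : Fin (constrCardB 𝔅 k)) {w w' : PBond (F.P K) 0 → lieSU (Fin N)}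
    (h : ∀ b ∈ feeds (((constrEnumB 𝔅 k).symm i).1 : ℕ) ((constrEnumB 𝔅 k).symm i).2.1, w b = w' b) :
    fderiv ℝ (msChartB F N K k 𝔅 W U) 0 w i = fderiv ℝ (msChartB F N K k 𝔅 W U) 0 w' i := by
  classical
  -- the restriction to the tower, as a continuous linear map
  set S : Set (PBond (F.P K) 0) := feeds (((constrEnumB 𝔅 k).symm i).1 : ℕ) ((constrEnumB 𝔅 k).symm i).2.1 with hS
  let P : (PBond (F.P K) 0 → lieSU (Fin N)) →L[ℝ] (PBond (F.P K) 0 → lieSU (Fin N)) :=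
    ContinuousLinearMap.pi fun b => if b ∈ S then ContinuousLinearMap.proj b else 0
  have hP : ∀ (Y : PBond (F.P K) 0 → lieSU (Fin N)) (b : PBond (F.P K) 0), P Y b = if b ∈ S then Y b else 0 := by
    intro Y b
    show (if b ∈ S then ContinuousLinearMap.proj (R := ℝ) b else (0 : (PBond (F.P K) 0 → lieSU (Fin N)) →L[ℝ] lieSU (Fin N))) Y = _
    split_ifs <;> rfl
  have hPS : ∀ (Y : PBond (F.P K) 0 → lieSU (Fin N)), ∀ b ∈ S, P Y b = Y b := fun Y b hb => by rw [hP, if_pos hb]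
  -- the `i`-th component factors through `P`
  have hfac : (fun X => msChartB F N K k 𝔅 W U X i) = (fun X => msChartB F N K k 𝔅 W U X i) ∘ P := by
    funext X
    exact msChartB_apply_congr_of_eqOn_feeds_right hk i fun b hb => (hPS X b hb).symm
  have hP0 : P 0 = 0 := map_zero P
  -- the component of `DΨ(0)` is the derivative of the component
  have hπ : HasFDerivAt (fun X => msChartB F N K k 𝔅 W U X i)
      ((ContinuousLinearMap.proj (R := ℝ) i : (Fin (constrCardB 𝔅 k) → lieSU (Fin N)) →L[ℝ] lieSU (Fin N)).comp (fderiv ℝ (msChartB F N K k 𝔅 W U) 0)) 0 :=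
    (ContinuousLinearMap.proj (R := ℝ) i : (Fin (constrCardB 𝔅 k) → lieSU (Fin N)) →L[ℝ] lieSU (Fin N)).hasFDerivAt.comp 0 hΨ.hasFDerivAt
  have hgi : DifferentiableAt ℝ (fun X => msChartB F N K k 𝔅 W U X i) 0 := hπ.differentiableAt
  have hD : fderiv ℝ (fun X => msChartB F N K k 𝔅 W U X i) 0 = (fderiv ℝ (fun X => msChartB F N K k 𝔅 W U X i) 0).comp P := by
    have hc : HasFDerivAt ((fun X => msChartB F N K k 𝔅 W U X i) ∘ P) ((fderiv ℝ (fun X => msChartB F N K k 𝔅 W U X i) 0).comp P) 0 := by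
      have hg : HasFDerivAt (fun X => msChartB F N K k 𝔅 W U X i) (fderiv ℝ (fun X => msChartB F N K k 𝔅 W U X i) 0) (P 0) := by
        rw [hP0]; exact hgi.hasFDerivAt
      exact hg.comp 0 P.hasFDerivAt
    rw [← hfac] at hc
    exact hc.fderiv
  have hcomp : ∀ v, fderiv ℝ (msChartB F N K k 𝔅 W U) 0 v i = fderiv ℝ (fun X => msChartB F N K k 𝔅 W U X i) 0 v := fun v => by
    rw [hπ.fderiv]; rfl
  have hPw : P w = P w' := by
    funext b
    rw [hP, hP]
    split_ifs with hb
    · exact h b hb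
    · rfl
  rw [hcomp, hcomp, hD, ContinuousLinearMap.comp_apply, ContinuousLinearMap.comp_apply, hPw]

/-! ## §2  The Γ₀ layer is exact -/

/-- ★★ **AT A LEVEL-0 CONSTRAINED BOND THE CHART IS THE COORDINATE ITSELF**: for `U` in the fibre `{M_𝐁(U) = W}` and a finest-scale constrained bond `c` (`c ∈ bondsOf (𝐁 0)` — on the
determining set of record this is every bond meeting `Γ₀ = Ω₁ᶜ`), the component of `Ψ_{𝐁,W,U}(X)` at the index of `(0, c)` equals `X c` for all `X` near `0` (`‖↑(X c)‖ < ln 2`): the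
level-0 «average» is the bond variable, `W₀(c) = U(c)` on the fibre, `log(U(c)*·U(c)·e^{X_c}) = X_c` — for EVERY `U`, no near-flatness.
[cite: Balaban1988Convergent, (2.2) p.255, (2.10)–(2.11) p.256; Balaban1985Variational, Sect. C (47)–(48) p.285; Balaban1985Averaging, (21)–(26) pp.21–22] -/
theorem msChartB_apply_levelZero_eventuallyEq (hU : AgreeOnB 𝔅 (avgFamily (avOfRecord F N K) U) W) (c : PBond (F.P K) 0) (hc : c ∈ 𝔅 0) :
    (fun X => msChartB F N K k 𝔅 W U X (constrEnumB 𝔅 k ⟨⟨0, Nat.succ_pos k⟩, c, hc⟩)) =ᶠ[𝓝 0] fun X => X c := by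
  have hnear : ∀ᶠ X : PBond (F.P K) 0 → lieSU (Fin N) in 𝓝 0, ‖((X c : lieSU (Fin N)) : Matrix (Fin N) (Fin N) ℂ)‖ < Real.log 2 := by
    have hcont : Continuous fun X : PBond (F.P K) 0 → lieSU (Fin N) => ‖((X c : lieSU (Fin N)) : Matrix (Fin N) (Fin N) ℂ)‖ :=
      ((lieSU (Fin N)).subtypeL.continuous.comp (continuous_apply c)).norm
    have h0 : ‖(((0 : PBond (F.P K) 0 → lieSU (Fin N)) c : lieSU (Fin N)) : Matrix (Fin N) (Fin N) ℂ)‖ < Real.log 2 := by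
      rw [Pi.zero_apply, Submodule.coe_zero, norm_zero]; exact Real.log_pos (by norm_num)
    exact hcont.continuousAt.eventually_lt continuousAt_const h0
  filter_upwards [hnear] with X hX
  have hWc : W 0 c = U c := (hU 0 c hc).symm
  rw [msChartB_apply, Equiv.symm_apply_apply]
  show suProj N (mlog (relAvg K W (expChart U X) 0 c)) = X c
  rw [relAvg, hWc]
  show suProj N (mlog (star ((U c : SU N) : Matrix (Fin N) (Fin N) ℂ) * ((expChart U X c : SU N) : Matrix (Fin N) (Fin N) ℂ))) = X c
  rw [coe_expChart, ← mul_assoc, star_coe_mul_coe_SU, one_mul, B7BlockAvgLog.mlog_exp hX, suProj_coe]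

/-- ★★ **THE DERIVATIVE AT A LEVEL-0 COMPONENT IS THE EVALUATION**: for `U` in the fibre with `Ψ` differentiable at `0`, `(DΨ(0) w) (idx (0,c)) = w c` — the Γ₀ layer of the linearised
constraint is the identity, for EVERY `U` (so the (δ₂)-defect `DΨ_{U}(0) − DΦ♭(0)` VANISHES there). [cite: Balaban1988Convergent, (2.2) p.255, (2.11)–(2.12) p.256; Balaban1985Variational, (82)–(83) p.290] -/
theorem fderiv_msChartB_apply_levelZero (hU : AgreeOnB 𝔅 (avgFamily (avOfRecord F N K) U) W) (hΨ : DifferentiableAt ℝ (msChartB F N K k 𝔅 W U) 0)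
    (c : PBond (F.P K) 0) (hc : c ∈ 𝔅 0) (w : PBond (F.P K) 0 → lieSU (Fin N)) :
    fderiv ℝ (msChartB F N K k 𝔅 W U) 0 w (constrEnumB 𝔅 k ⟨⟨0, Nat.succ_pos k⟩, c, hc⟩) = w c := by
  have h1 : HasFDerivAt (fun X => msChartB F N K k 𝔅 W U X (constrEnumB 𝔅 k ⟨⟨0, Nat.succ_pos k⟩, c, hc⟩))
      ((ContinuousLinearMap.proj (R := ℝ) (constrEnumB 𝔅 k ⟨⟨0, Nat.succ_pos k⟩, c, hc⟩) : (Fin (constrCardB 𝔅 k) → lieSU (Fin N)) →L[ℝ] lieSU (Fin N)).comp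
        (fderiv ℝ (msChartB F N K k 𝔅 W U) 0)) 0 :=
    (ContinuousLinearMap.proj (R := ℝ) (constrEnumB 𝔅 k ⟨⟨0, Nat.succ_pos k⟩, c, hc⟩) : (Fin (constrCardB 𝔅 k) → lieSU (Fin N)) →L[ℝ] lieSU (Fin N)).hasFDerivAt.comp 0
      hΨ.hasFDerivAt
  have h2 : HasFDerivAt (fun X : PBond (F.P K) 0 → lieSU (Fin N) => X c)
      (ContinuousLinearMap.proj (R := ℝ) c : (PBond (F.P K) 0 → lieSU (Fin N)) →L[ℝ] lieSU (Fin N)) 0 :=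
    (ContinuousLinearMap.proj (R := ℝ) c : (PBond (F.P K) 0 → lieSU (Fin N)) →L[ℝ] lieSU (Fin N)).hasFDerivAt
  have h3 : HasFDerivAt (fun X => msChartB F N K k 𝔅 W U X (constrEnumB 𝔅 k ⟨⟨0, Nat.succ_pos k⟩, c, hc⟩)) (ContinuousLinearMap.proj c) 0 :=
    h2.congr_of_eventuallyEq (msChartB_apply_levelZero_eventuallyEq hU c hc)
  have heq := h1.unique h3
  have := congrArg (fun L : (PBond (F.P K) 0 → lieSU (Fin N)) →L[ℝ] lieSU (Fin N) => L w) heq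
  simpa using this

/-- ★★ **NO CHART CURVATURE ON THE Γ₀ LAYER**: for `U` in the fibre with `Ψ` differentiable near `0` and twice at `0` (the guard's regularity binders), `(D²Ψ(0)(w, w′)) (idx (0,c)) = 0`
— the component is eventually LINEAR, so its second derivative vanishes (and with it the level-0 part of the multiplier term `λ(Ψ₂(w,w))` of (μ)).
[cite: Balaban1988Convergent, (2.2) p.255, (2.11)–(2.12) p.256; Balaban1985Variational, (81)–(83) p.290] -/
theorem fderiv_fderiv_msChartB_apply_levelZero (hU : AgreeOnB 𝔅 (avgFamily (avOfRecord F N K) U) W)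
    (hd : ∀ᶠ X in 𝓝 (0 : PBond (F.P K) 0 → lieSU (Fin N)), DifferentiableAt ℝ (msChartB F N K k 𝔅 W U) X)
    (hd2 : DifferentiableAt ℝ (fderiv ℝ (msChartB F N K k 𝔅 W U)) 0)
    (c : PBond (F.P K) 0) (hc : c ∈ 𝔅 0) (w w' : PBond (F.P K) 0 → lieSU (Fin N)) :
    fderiv ℝ (fderiv ℝ (msChartB F N K k 𝔅 W U)) 0 w w' (constrEnumB 𝔅 k ⟨⟨0, Nat.succ_pos k⟩, c, hc⟩) = 0 := by
  have hpi := fderiv_fderiv_apply_pi hd hd2 (constrEnumB 𝔅 k ⟨⟨0, Nat.succ_pos k⟩, c, hc⟩) w w'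
  have h2 := congrArg (fun L : (PBond (F.P K) 0 → lieSU (Fin N)) →L[ℝ] (PBond (F.P K) 0 → lieSU (Fin N)) →L[ℝ] lieSU (Fin N) => L w w')
    (fderiv_fderiv_congr_of_eventuallyEq (msChartB_apply_levelZero_eventuallyEq (k := k) hU c hc))
  refine hpi.trans (h2.trans ?_)
  have hlin : fderiv ℝ (fun X : PBond (F.P K) 0 → lieSU (Fin N) => X c)
      = fun _ => (ContinuousLinearMap.proj (R := ℝ) c : (PBond (F.P K) 0 → lieSU (Fin N)) →L[ℝ] lieSU (Fin N)) := by
    funext X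
    exact (ContinuousLinearMap.proj (R := ℝ) c : (PBond (F.P K) 0 → lieSU (Fin N)) →L[ℝ] lieSU (Fin N)).hasFDerivAt.fderiv
  show fderiv ℝ (fderiv ℝ (fun X : PBond (F.P K) 0 → lieSU (Fin N) => X c)) 0 w w' = 0
  rw [hlin, fderiv_const_apply]
  rfl

end Literature.MathematicalPhysics.QuantumFieldTheory.Balaban1983to89.Node00

end
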